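import Summits.CriticalPhenomena.PercolationContinuityZ3.Theorems.PercNearOneGluingNoHeavyQuantVolumeTailWindowRigidity
import Summits.CriticalPhenomena.PercolationContinuityZ3.Theorems.PercNearOneGluingNoHeavyQuantVolumeTailDerivLower
import HarnessLib

/-!
# IN HIGH DIMENSIONS THE CLUSTER-SIZE TAILS ARE UNIFORMLY BI-LIPSCHITZ IN `p` ACROSS THE PARABOLIC WINDOW:
# `TriangleCondition d ⟹ ∃ k₀ s₀ L, 0 < b ≤ B: b ≤ (d/dr)P_r(|C| ≥ k) ≤ B` for all `k ≥ k₀`, `0 < s ≤ s₀`, `k·s² ≤ L`, `|r − p_c| ≤ s`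
# — UNCONDITIONAL for every triangle-condition dimension and all `d ≥ D`; explicit under the one-sided mean-field tail `a_k ≤ C₁k^{−1/2}`
# — quant lane, METHOD = differential inequalities near `p_c`, seat p4 gen 37, file 8 (capstone of files 2, 3, 6, 7)

builds on p205010 (kernel theorem, internal audit signed; external expert review pending).  (Nothing in THIS file uses p205010.)

Seat `prim-quant-p4`, `--supports stmt-CriticalPhenomena-4575`; pure proofs, no definitions (`local notation3` only).
Notation: `A[k, q] = P_{PR q}(|C(0)| ≥ k)`, `S[k, p] = E_p[|C| ∧ k]`, `PC = p_c`, `a_k = P_{p_c}(|C| ≥ k)`, `S_k = S[k, p_c]`.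

THE POINT.  The generation's derivative theorems, assembled: the O'Donnell–Servedio mean-revealment bound (files 2–3:
`a_k'(r) ≤ 4√(4dC₁²/(r(1−r)))` on `(0, p_c + s]` in the window) and Hutchcroft's (1.3) with the product floor and the hypothesis-free
windows (files 6–7: `2r(1−r)a_k'(r) ≥ (1−e⁻¹)p_c(1−p_c)/(12288dC₁²) − 3C₁k^{−1/2}` on `[p_c − s, p_c + s]`) give, under the ONE-SIDED
mean-field tail `a_k ≤ C₁k^{−1/2}` and for `0 < s ≤ min(p_c,1−p_c)/2`, `k·s² ≤ (p_c(1−p_c)/(256dC₁))²`, `|r − p_c| ≤ s`: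
  **`2·[(1−e⁻¹)p_c(1−p_c)/(12288dC₁²) − 3C₁k^{−1/2}] ≤ (d/dr)P_r(|C| ≥ k) ≤ 4√(16dC₁²/(p_c(1−p_c)))`**
(`VolOS.hasDerivAt_volTail_twoSided_window_of_mf_tail`), hence for `k ≥ k₀(d, C₁)` a two-sided bound `0 < b ≤ a_k'(r) ≤ B` uniform in
`k` and in `r` throughout the parabolic window `k(r − p_c)² ≤ L`; **UNCONDITIONAL under the triangle condition**
(`volTail_deriv_biLipschitz_window_of_triangle`; `meanField_of_triangle` gives the envelope) **and for all `d ≥ D`**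
(`volTail_deriv_biLipschitz_window_high_dim`; `HaraSlade1990_triangleCondition_holds`), standard axioms.  Reading: in high dimensions
the whole one-parameter family of critical cluster-size tails `p ↦ P_p(|C| ≥ k)` crosses the window `|p − p_c| ≲ k^{−1/2}` LINEARLY with
slope `≍ 1` (mean field / binary tree: `a_k'(p) → const` there, order-sharp); the lane's census V64 in its strongest form.

HONEST STATUS.  NEW AS TYPED; ELEMENTARY assembly of this generation's files 2, 3, 6, 7 (all on printed, tree-proved inequalities).
NO rate, NO exponent value for `d = 3` (there `δ > 2` is expected and the window bounds do not meet); (T1)/(T2) and the lane's honest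
sentence UNCHANGED.

## References
* T. Hutchcroft, Probab. Math. Phys. 1 (2020) 147–165, eq. (1.3) [Hutchcroft2020]; J. Stat. Phys. 189 (2022) no. 6, Thm. 1.3
  [Hutchcroft2022Triangle].
* R. O'Donnell, *Analysis of Boolean Functions* (2014), §8.6 (OS inequality) [ODonnell2014].
* R. Fitzner, R. van der Hofstad, Electron. J. Probab. 22 (2017), (1.6)–(1.8) [FitznerVanDerHofstad2017]; T. Hara, G. Slade,
  Comm. Math. Phys. 128 (1990), Thm. 1.1 [HaraSlade1990].
-/

noncomputable section

namespace Summit.CriticalPhenomena.PercolationContinuityZ3.Theorems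

open MeasureTheory Finset Literature.Probability.Percolation Literature.Probability.LatticeModels
open Literature.Probability.Percolation.GhostExploration Literature.Probability.FitznerVanDerHofstad2017
open Literature.Barriers.CriticalPhenomena
open scoped Classical

namespace VolOS

variable {d : ℕ}

local notation3 "PR[" q "]" => (Set.projIcc (0 : ℝ) 1 zero_le_one q)
local notation3 "A[" k ", " q "]" => (bondPercolation (zdGraph d) (Set.projIcc (0 : ℝ) 1 zero_le_one q)).real (clusterSizeGe (0 : Site d) (k : ℕ))
local notation3 "S[" k ", " p "]" => ∑ j ∈ Finset.Icc 1 k, (bondPercolation (zdGraph d) p).real (clusterSizeGe (0 : Site d) j)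
local notation3 "PC" => ((criticalProbI d : unitInterval) : ℝ)

/-! ### §1. Explicit two-sided window bound under the mean-field upper tail -/

/-- **TWO-SIDED DERIVATIVE BOUND THROUGHOUT THE PARABOLIC WINDOW (mean-field upper tail, explicit).**  `d ≥ 2`,
`P_{p_c}(|C| ≥ j) ≤ C₁j^{−1/2}` (`j ≥ 1`).  For `0 < s ≤ min(p_c, 1−p_c)/2`, `k ≥ 1` with `k·s² ≤ (p_c(1−p_c)/(256dC₁))²` and every
`r ∈ [p_c − s, p_c + s]`: `d/dr P_r(|C| ≥ k) = D` with
**`2·[(1−e⁻¹)p_c(1−p_c)/(12288dC₁²) − 3C₁k^{−1/2}] ≤ D ≤ 4√(16dC₁²/(p_c(1−p_c)))`** (the window condition implies the floor-form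
conditions `s·S_k ≤ p_c(1−p_c)/(128d)`, `k s² ≤ p_c(1−p_c)/(64d)` since `S_k² ≤ 4C₁²k`; `r(1−r) ≥ p_c(1−p_c)/4`).
[cite: Hutchcroft2020, eq. (1.3)] [cite: ODonnell2014, §8.6 OS Inequality] [cite: Hutchcroft2022Triangle, Thm. 1.3] -/
theorem hasDerivAt_volTail_twoSided_window_of_mf_tail (hd : 2 ≤ d) {C₁ : ℝ}
    (hUp : ∀ k : ℕ, 1 ≤ k → (bondPercolation (zdGraph d) (criticalProbI d)).real (clusterSizeGe (0 : Site d) k) ≤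
      C₁ * (k : ℝ) ^ (-(1 / (2 : ℝ))))
    {s : ℝ} (hs0 : 0 < s) (hs1 : s ≤ PC / 2) (hs2 : s ≤ (1 - PC) / 2) {k : ℕ} (hk : 1 ≤ k)
    (hks : (k : ℝ) * s ^ 2 ≤ (PC * (1 - PC) / (256 * d * C₁)) ^ 2) {r : ℝ} (hr : r ∈ Set.Icc (PC - s) (PC + s)) :
    ∃ D : ℝ, HasDerivAt (fun q : ℝ => A[k, q]) D r ∧
      2 * ((1 - Real.exp (-1)) * (PC * (1 - PC)) / (12288 * d * C₁ ^ 2) - 3 * C₁ * (k : ℝ) ^ (-(1 / (2 : ℝ)))) ≤ D ∧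
      D ≤ 4 * Real.sqrt (16 * d * C₁ ^ 2 / (PC * (1 - PC))) := by
  have hpc : PC ∈ Set.Ioo (0 : ℝ) 1 :=
    ⟨ChiF.criticalProbI_pos hd, by rw [coe_criticalProbI]; exact criticalProb_zd_lt_one hd⟩
  have hd0 : (0 : ℝ) < d := by exact_mod_cast (show 0 < d by omega)
  have hd2 : (2 : ℝ) ≤ d := by exact_mod_cast hd
  have hC₁ : 1 ≤ C₁ := by
    have h := hUp 1 le_rfl
    simp only [Nat.cast_one, Real.one_rpow, mul_one] at h
    exact le_trans (by rw [CritProduct.real_clusterSizeGe_one]) h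
  have hC0 : 0 < C₁ := by linarith
  have hC1sq : 1 ≤ C₁ ^ 2 := by nlinarith
  have hP0 : 0 < 1 - PC := by linarith [hpc.2]
  have hP20 : 0 < PC * (1 - PC) := mul_pos hpc.1 hP0
  have hP21 : PC * (1 - PC) ≤ 1 := by nlinarith [hpc.1, hpc.2]
  have hr01 : r ∈ Set.Ioo (0 : ℝ) 1 := ⟨by linarith [hr.1, hpc.1], by linarith [hr.2, hpc.2]⟩
  have hk0 : (0 : ℝ) < k := by exact_mod_cast hk
  have hS2 := volSum_sq_le_of_mf_tail hUp hk
  have hS1 : 1 ≤ S[k, criticalProbI d] := one_le_volSum (d := d) hk (criticalProbI d)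
  -- the floor-form window conditions follow from `k s² ≤ (p_c(1−p_c)/(256dC₁))²`
  have hsS : s * S[k, criticalProbI d] ≤ PC * (1 - PC) / (128 * d) := by
    refine le_of_pow_le_pow_left₀ two_ne_zero (by positivity) ?_
    calc (s * S[k, criticalProbI d]) ^ 2 = s ^ 2 * S[k, criticalProbI d] ^ 2 := by ring
      _ ≤ s ^ 2 * (4 * C₁ ^ 2 * k) := by gcongr
      _ = 4 * C₁ ^ 2 * ((k : ℝ) * s ^ 2) := by ring
      _ ≤ 4 * C₁ ^ 2 * (PC * (1 - PC) / (256 * d * C₁)) ^ 2 := by gcongr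
      _ = (PC * (1 - PC) / (128 * d)) ^ 2 := by field_simp; ring
  have hks' : (k : ℝ) * s ^ 2 ≤ PC * (1 - PC) / (64 * d) := by
    refine hks.trans ?_
    have h1 : (PC * (1 - PC) / (256 * d * C₁)) ^ 2 = PC * (1 - PC) / (64 * d) * (PC * (1 - PC) / (1024 * d * C₁ ^ 2)) := by
      field_simp; ring
    have h2 : PC * (1 - PC) / (1024 * d * C₁ ^ 2) ≤ 1 := by
      rw [div_le_one (by positivity)]
      nlinarith
    rw [h1]
    exact mul_le_of_le_one_right (by positivity) h2
  -- lower bound (file 6), upper bound with `0 ≤ D` (files 2–3)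
  obtain ⟨D, hD, hlow⟩ := hasDerivAt_volTail_ge_window_of_mf_tail hd hUp hs0 hs1 hs2 hk hsS hks' hr
  have hup : ∃ D' : ℝ, HasDerivAt (fun q : ℝ => A[k, q]) D' r ∧ 0 ≤ D' ∧
      D' ≤ 4 * Real.sqrt (4 * d * C₁ ^ 2 / (r * (1 - r))) := by
    rcases le_or_gt r PC with hrc | hrc
    · obtain ⟨D', hD', h0, hle⟩ := hasDerivAt_volTail_le_rpow_of_upper_tail hd (δ := 2) (by norm_num) hUp hk hr01 hrc
      refine ⟨D', hD', h0, hle.trans ?_⟩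
      have hq : 0 ≤ Real.sqrt (4 * d * C₁ ^ 2 / (r * (1 - r))) := Real.sqrt_nonneg _
      have he : Real.sqrt (2 * d * C₁ ^ 2 / ((1 - 1 / (2 : ℝ)) * (r * (1 - r)))) * (k : ℝ) ^ (1 / 2 - 1 / (2 : ℝ)) =
          Real.sqrt (4 * d * C₁ ^ 2 / (r * (1 - r))) := by
        rw [show (1 : ℝ) / 2 - 1 / 2 = 0 by ring, Real.rpow_zero, mul_one]
        congr 1
        rw [show (1 : ℝ) - 1 / 2 = 1 / 2 by norm_num]
        field_simp
        norm_num
      rw [he]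
      linarith
    · have hks'' : (k : ℝ) * s ^ 2 ≤ PC * (1 - PC) / (32 * d) :=
        hks'.trans (div_le_div_of_nonneg_left hP20.le (by positivity) (by linarith))
      exact hasDerivAt_volTail_le_supercrit_window_of_mf_tail hd hUp hs0 hs2 hk hks'' ⟨hrc.le, hr.2⟩
  obtain ⟨D', hD', hD'0, hD'le⟩ := hup
  have hDD : D = D' := hD.unique hD'
  have hD0 : 0 ≤ D := hDD ▸ hD'0
  refine ⟨D, hD, ?_, ?_⟩
  · -- `X ≤ 2r(1−r)·D ≤ D/2`
    have hrr1 : 2 * (r * (1 - r)) ≤ 1 / 2 := by nlinarith [sq_nonneg (r - 1 / 2)]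
    nlinarith [hlow, hrr1, hD0]
  · have h1 : PC / 2 ≤ r := by linarith [hr.1]
    have h2 : (1 - PC) / 2 ≤ 1 - r := by linarith [hr.2]
    have hrr : PC * (1 - PC) / 4 ≤ r * (1 - r) := by
      calc PC * (1 - PC) / 4 = (PC / 2) * ((1 - PC) / 2) := by ring
        _ ≤ r * (1 - r) := mul_le_mul h1 h2 (by linarith) (by linarith [hpc.1])
    have hle : 4 * d * C₁ ^ 2 / (r * (1 - r)) ≤ 16 * d * C₁ ^ 2 / (PC * (1 - PC)) := by
      rw [div_le_div_iff₀ (by nlinarith [hr01.1, hr01.2]) hP20]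
      have h4 : 0 ≤ 4 * d * C₁ ^ 2 := by positivity
      nlinarith [hrr, h4]
    calc D = D' := hDD
      _ ≤ 4 * Real.sqrt (4 * d * C₁ ^ 2 / (r * (1 - r))) := hD'le
      _ ≤ 4 * Real.sqrt (16 * d * C₁ ^ 2 / (PC * (1 - PC))) := by gcongr

/-! ### §2. Unconditional: the triangle condition, and all sufficiently high dimensions -/

/-- **UNCONDITIONAL UNDER THE TRIANGLE CONDITION: THE CLUSTER-SIZE TAILS ARE UNIFORMLY BI-LIPSCHITZ ACROSS THE PARABOLIC WINDOW.**
`d ≥ 2`, `TriangleCondition d`.  There are `k₀` and `s₀, L, b, B > 0` such that for every `0 < s ≤ s₀`, every `k ≥ k₀` with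
`k·s² ≤ L` and every `r ∈ [p_c − s, p_c + s]`: `d/dr P_r(|C(0)| ≥ k) = D` with **`b ≤ D ≤ B`** (`δ = 2` in the bounded-ratio sense
under the triangle condition, `meanField_of_triangle`; §1 with `k₀` absorbing `3C₁k^{−1/2}`).
[cite: FitznerVanDerHofstad2017, Thm. 1.2 / (1.8)] [cite: Hutchcroft2020, eq. (1.3)] [cite: ODonnell2014, §8.6 OS Inequality] -/
theorem volTail_deriv_biLipschitz_window_of_triangle (hd : 2 ≤ d) (hT : TriangleCondition d) :
    ∃ k₀ : ℕ, ∃ s₀ L b B : ℝ, 0 < s₀ ∧ 0 < L ∧ 0 < b ∧ ∀ s : ℝ, 0 < s → s ≤ s₀ → ∀ k : ℕ, k₀ ≤ k →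
      (k : ℝ) * s ^ 2 ≤ L → ∀ r ∈ Set.Icc (PC - s) (PC + s),
        ∃ D : ℝ, HasDerivAt (fun q : ℝ => A[k, q]) D r ∧ b ≤ D ∧ D ≤ B := by
  have hpc : PC ∈ Set.Ioo (0 : ℝ) 1 :=
    ⟨ChiF.criticalProbI_pos hd, by rw [coe_criticalProbI]; exact criticalProb_zd_lt_one hd⟩
  have hd0 : (0 : ℝ) < d := by exact_mod_cast (show 0 < d by omega)
  obtain ⟨C₁, hC0, hUp⟩ := upper_tail_of_deltaEqTwo (meanField_of_triangle hd hT).2.2.2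
  have hP0 : 0 < 1 - PC := by linarith [hpc.2]
  have hP20 : 0 < PC * (1 - PC) := mul_pos hpc.1 hP0
  have he : 0 < 1 - Real.exp (-1) := by linarith [Real.exp_lt_one_iff.2 (show (-1 : ℝ) < 0 by norm_num)]
  -- `X = (1−e⁻¹)p_c(1−p_c)/(12288dC₁²)`; `k₀` makes `3C₁k^{−1/2} ≤ X/2`
  have hX0 : 0 < (1 - Real.exp (-1)) * (PC * (1 - PC)) / (12288 * d * C₁ ^ 2) := by positivity
  set X : ℝ := (1 - Real.exp (-1)) * (PC * (1 - PC)) / (12288 * d * C₁ ^ 2) with hX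
  set Y : ℝ := 6 * C₁ / X with hY
  have hY0 : 0 < Y := by positivity
  refine ⟨⌈Y ^ 2⌉₊ + 1, min (PC / 2) ((1 - PC) / 2), (PC * (1 - PC) / (256 * d * C₁)) ^ 2, X,
    4 * Real.sqrt (16 * d * C₁ ^ 2 / (PC * (1 - PC))), lt_min (by linarith [hpc.1]) (by linarith), by positivity, hX0,
    fun s hs0 hs k hk hks r hr => ?_⟩
  have hk1 : 1 ≤ k := by omega
  have hk0 : (0 : ℝ) < k := by exact_mod_cast hk1
  obtain ⟨D, hD, hlo, hhi⟩ := hasDerivAt_volTail_twoSided_window_of_mf_tail hd hUp hs0 (hs.trans (min_le_left _ _))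
    (hs.trans (min_le_right _ _)) hk1 hks hr
  refine ⟨D, hD, le_trans ?_ hlo, hhi⟩
  -- `3C₁k^{−1/2} ≤ X/2` for `k ≥ Y² = (6C₁/X)²`
  have hkY : Y ^ 2 ≤ k := by
    have h1 : Y ^ 2 ≤ ⌈Y ^ 2⌉₊ := Nat.le_ceil _
    have h2 : ((⌈Y ^ 2⌉₊ : ℕ) : ℝ) ≤ k := by exact_mod_cast (by omega : ⌈Y ^ 2⌉₊ ≤ k)
    linarith
  have hsk : Y ≤ Real.sqrt k := by
    rw [← Real.sqrt_sq hY0.le]; exact Real.sqrt_le_sqrt hkY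
  have hterm : 3 * C₁ * (k : ℝ) ^ (-(1 / (2 : ℝ))) ≤ X / 2 := by
    rw [← div_sqrt_eq_mul_rpow hk0]
    calc 3 * C₁ / Real.sqrt k ≤ 3 * C₁ / Y := by gcongr
      _ = X / 2 := by rw [hY]; field_simp; norm_num
  linarith

/-- **IN ALL SUFFICIENTLY HIGH DIMENSIONS THE CLUSTER-SIZE TAILS OF `ℤ^d` ARE UNIFORMLY BI-LIPSCHITZ IN `p` ACROSS THE PARABOLIC
NEAR-CRITICAL WINDOW**: there is `D > 6` such that for every `d ≥ D` there are `k₀` and `s₀, L, b, B > 0` with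
`b ≤ (d/dr)P_r(|C(0)| ≥ k) ≤ B` for all `0 < s ≤ s₀`, `k ≥ k₀`, `k·s² ≤ L`, `|r − p_c(ℤ^d)| ≤ s` (Hara–Slade: the triangle condition
holds for `d ≥ D`, tree `HaraSlade1990_triangleCondition_holds`).  Standard axioms; unconditional.
[cite: HaraSlade1990, Thm. 1.1] [cite: Hutchcroft2020, eq. (1.3)] [cite: ODonnell2014, §8.6 OS Inequality] -/
theorem volTail_deriv_biLipschitz_window_high_dim :
    ∃ D : ℕ, 6 < D ∧ ∀ d' : ℕ, D ≤ d' → ∃ k₀ : ℕ, ∃ s₀ L b B : ℝ, 0 < s₀ ∧ 0 < L ∧ 0 < b ∧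
      ∀ s : ℝ, 0 < s → s ≤ s₀ → ∀ k : ℕ, k₀ ≤ k → (k : ℝ) * s ^ 2 ≤ L →
        ∀ r ∈ Set.Icc (((criticalProbI d' : unitInterval) : ℝ) - s) (((criticalProbI d' : unitInterval) : ℝ) + s),
          ∃ D' : ℝ, HasDerivAt (fun q : ℝ => (bondPercolation (zdGraph d') (Set.projIcc (0 : ℝ) 1 zero_le_one q)).real
            (clusterSizeGe (0 : Site d') k)) D' r ∧ b ≤ D' ∧ D' ≤ B := by
  obtain ⟨D, hD, hT⟩ := HaraSlade1990_triangleCondition_holds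
  exact ⟨D, hD, fun d' hd' => volTail_deriv_biLipschitz_window_of_triangle (d := d') (by omega) (hT d' hd')⟩

end VolOS

end Summit.CriticalPhenomena.PercolationContinuityZ3.Theorems
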